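import Mathlib
import Summits.AnomalousDissipation.AnomalousDissipation.Theorems.ConeDesingularisation.Negative.BlowdownShells

/-!
# Flux transfer IV: radial cutoffs, the averaging integral, shell bookkeeping

Part of the flux-transfer package for the crux `ConeDesingularisation ↔ CascadeSoliton`
(stmt-AnomalousDissipation-19034/19036, route `PointSink`); headline and overview in
`…/ConeDesingularisation/Negative/FedConeFlux.lean`.

A smooth radial profile (`= 1` below `ρ₁`, `= 0` above `ρ₂`, `exists_smoothProfile`), the derivative
of the dilated cutoff `x ↦ G(‖x‖²/c²)`, the closed form `∫_1^λ c⁻¹ G'(s/c²) 2c⁻² dc = (G(s) − G(s/λ²))/s`,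
and the shell bookkeeping identity `∫ (G(‖x‖²) − G(‖x‖²/λ²)) f = −∫_{1<‖x‖<λ} f` for densities with the
exact covariance `f(λy) = λ⁻³ f(y)`. [folklore]
-/

-- `Summit.<Summit>.<Problem>` is the tree's mandated summit-side namespace (CONVENTIONS §2).
set_option linter.dupNamespace false

noncomputable section

namespace Summit.AnomalousDissipation.AnomalousDissipation.Theorems.ConeDesingularisation.Negative

open MeasureTheory Filter Topology Set Metric
open scoped InnerProductSpace ContDiff
open Literature.Analysis.FluidPDE.EulerReynoldsLadder (isCompact_shell shell_subset_ne_zero)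

/-! ### §5 From a constant smooth-cutoff flux to the sharp log-mean flux law -/

/-- A smooth radial cutoff profile: `G = 1` on `(-∞, ρ₁]` and `G = 0` on `[ρ₂, ∞)` (`ρ₁ < ρ₂`),
built from `Real.smoothTransition`. [folklore] -/
theorem exists_smoothProfile {ρ₁ ρ₂ : ℝ} (h : ρ₁ < ρ₂) :
    ∃ G : ℝ → ℝ, ContDiff ℝ ∞ G ∧ (∀ s, s ≤ ρ₁ → G s = 1) ∧ ∀ s, ρ₂ ≤ s → G s = 0 :=
  ⟨fun s => Real.smoothTransition ((ρ₂ - s) / (ρ₂ - ρ₁)),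
    Real.smoothTransition.contDiff.comp ((contDiff_const.sub contDiff_id).div_const _),
    fun s hs => Real.smoothTransition.one_of_one_le ((one_le_div (sub_pos.2 h)).2 (by linarith)),
    fun s hs => Real.smoothTransition.zero_of_nonpos
      (div_nonpos_of_nonpos_of_nonneg (by linarith) (sub_pos.2 h).le)⟩

/-- The derivative of a profile that is locally constant off `[ρ₁, ρ₂]` vanishes off `[ρ₁, ρ₂]`.
[folklore] -/
theorem deriv_eq_zero_of_profile {G : ℝ → ℝ} {ρ₁ ρ₂ : ℝ} (hG1 : ∀ s, s ≤ ρ₁ → G s = 1)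
    (hG0 : ∀ s, ρ₂ ≤ s → G s = 0) {s : ℝ} (hs : s ∉ Icc ρ₁ ρ₂) : deriv G s = 0 := by
  rw [mem_Icc, not_and_or, not_le, not_le] at hs
  rcases hs with h | h
  · have hev : G =ᶠ[𝓝 s] fun _ => (1 : ℝ) := by
      filter_upwards [(isOpen_gt' ρ₁).mem_nhds h] with t ht using hG1 t (le_of_lt ht)
    rw [hev.deriv_eq, deriv_const]
  · have hev : G =ᶠ[𝓝 s] fun _ => (0 : ℝ) := by
      filter_upwards [(isOpen_lt' ρ₂).mem_nhds h] with t ht using hG0 t (le_of_lt ht)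
    rw [hev.deriv_eq, deriv_const]

/-- Derivative of the dilated radial cutoff `x ↦ G(‖x‖²/c²)`:
`D[G(‖·‖²/c²)](x) = G'(‖x‖²/c²) · c⁻² · 2⟪x, ·⟫`. [folklore] -/
theorem hasFDerivAt_radialCutoff {G : ℝ → ℝ} (hG : Differentiable ℝ G) (c : ℝ) (x : EuclideanSpace ℝ (Fin 3)) :
    HasFDerivAt (fun y : EuclideanSpace ℝ (Fin 3) => G (‖y‖ ^ 2 / c ^ 2))
      (deriv G (‖x‖ ^ 2 / c ^ 2) • ((c ^ 2)⁻¹ • (2 • innerSL ℝ x))) x := by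
  have h1 : HasFDerivAt (fun y : EuclideanSpace ℝ (Fin 3) => ‖y‖ ^ 2 / c ^ 2) ((c ^ 2)⁻¹ • (2 • innerSL ℝ x)) x := by
    have := (hasStrictFDerivAt_norm_sq x).hasFDerivAt.mul_const (c ^ 2)⁻¹
    simpa [div_eq_mul_inv] using this
  exact (hG _).hasDerivAt.comp_hasFDerivAt x h1

/-- The dilated radial cutoff paired with a vector: `D[G(‖·‖²/c²)](x)[v] = G'(‖x‖²/c²) c⁻² 2⟪x, v⟫`.
[folklore] -/
theorem fderiv_radialCutoff_apply {G : ℝ → ℝ} (hG : Differentiable ℝ G) (c : ℝ) (x v : EuclideanSpace ℝ (Fin 3)) :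
    fderiv ℝ (fun y : EuclideanSpace ℝ (Fin 3) => G (‖y‖ ^ 2 / c ^ 2)) x v =
      deriv G (‖x‖ ^ 2 / c ^ 2) * ((c ^ 2)⁻¹ * (2 * ⟪x, v⟫_ℝ)) := by
  rw [(hasFDerivAt_radialCutoff hG c x).fderiv]
  simp [innerSL_apply_apply, two_smul]
  ring

/-- **The averaging integral.** For `s > 0` and `1 ≤ λ`:
`∫_{1}^{λ} c⁻¹ G'(s/c²) c⁻² 2 dc = (G(s) − G(s/λ²)) / s` (substitution `t = s/c²`). [folklore] -/
theorem radial_inner_integral {G : ℝ → ℝ} (hG : ContDiff ℝ ∞ G) {s : ℝ} (hs : 0 < s) {lam : ℝ}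
    (hlam : 1 ≤ lam) :
    ∫ c in Icc 1 lam, c⁻¹ * (deriv G (s / c ^ 2) * ((c ^ 2)⁻¹ * 2)) =
      (G s - G (s / lam ^ 2)) / s := by
  have hGd : Differentiable ℝ G := hG.differentiable (by simp)
  have hGc : Continuous (deriv G) := hG.continuous_deriv (by simp)
  rw [integral_Icc_eq_integral_Ioc, ← intervalIntegral.integral_of_le hlam]
  have hderiv : ∀ c ∈ uIcc 1 lam, HasDerivAt (fun c : ℝ => -(G (s / c ^ 2)) / s)
      (c⁻¹ * (deriv G (s / c ^ 2) * ((c ^ 2)⁻¹ * 2))) c := by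
    intro c hc
    rw [uIcc_of_le hlam] at hc
    have hc0 : c ≠ 0 := (one_pos.trans_le hc.1).ne'
    have hs0 : s ≠ 0 := hs.ne'
    have h2 : HasDerivAt (fun c : ℝ => c ^ 2) (2 * c) c := by
      simpa using hasDerivAt_pow 2 c
    have h1 : HasDerivAt (fun c : ℝ => s / c ^ 2) (-(s * (2 * c)) / (c ^ 2) ^ 2) c :=
      ((hasDerivAt_const c s).div h2 (pow_ne_zero 2 hc0)).congr_deriv (by ring)
    have h3 : HasDerivAt (fun c : ℝ => G (s / c ^ 2))
        (deriv G (s / c ^ 2) * (-(s * (2 * c)) / (c ^ 2) ^ 2)) c := (hGd _).hasDerivAt.comp c h1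
    exact ((h3.neg).div_const s).congr_deriv (by field_simp)
  have hint : IntervalIntegrable (fun c : ℝ => c⁻¹ * (deriv G (s / c ^ 2) * ((c ^ 2)⁻¹ * 2)))
      volume 1 lam := by
    refine ContinuousOn.intervalIntegrable ?_
    rw [uIcc_of_le hlam]
    refine continuousOn_of_forall_continuousAt fun c hc => ?_
    have hc0 : c ≠ 0 := (one_pos.trans_le hc.1).ne'
    have hc2 : c ^ 2 ≠ 0 := pow_ne_zero 2 hc0
    exact (continuousAt_inv₀ hc0).mul
      (((hGc.continuousAt).comp (f := fun c : ℝ => s / c ^ 2)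
        ((continuousAt_const.div ((continuous_pow 2).continuousAt) hc2))).mul
        ((continuousAt_inv₀ hc2).comp (f := fun c : ℝ => c ^ 2) ((continuous_pow 2).continuousAt)
          |>.mul continuousAt_const))
  rw [intervalIntegral.integral_eq_sub_of_hasDerivAt hderiv hint]
  simp only [one_pow, div_one]
  ring

open scoped Pointwise in
/-- **Shell bookkeeping.** Let `f` be integrable on the closed double shell `1 ≤ ‖x‖ ≤ λ²` with the
exact scaling `f(λy) = λ⁻³ f(y)` off the origin, and `G` continuous with `G = 1` on `(-∞, r²]`,
`G = 0` on `[b², ∞)`, `1 < r`, `b ≤ λ`. Then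
`∫ (G(‖x‖²) − G(‖x‖²/λ²)) f(x) dx = −∫_{1<‖x‖<λ} f`. [folklore] -/
theorem shell_bookkeeping {lam : ℝ} (hlam : 1 < lam) {f : EuclideanSpace ℝ (Fin 3) → ℝ}
    (hfi : IntegrableOn f {x : EuclideanSpace ℝ (Fin 3) | 1 ≤ ‖x‖ ∧ ‖x‖ ≤ lam ^ 2} volume)
    (hsc : ∀ y : EuclideanSpace ℝ (Fin 3), y ≠ 0 → f (lam • y) = (lam ^ 3)⁻¹ * f y)
    {G : ℝ → ℝ} (hGc : Continuous G) {r b : ℝ} (hr : 1 < r) (hb0 : 0 < b) (hb : b ≤ lam)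
    (hG1 : ∀ s, s ≤ r ^ 2 → G s = 1) (hG0 : ∀ s, b ^ 2 ≤ s → G s = 0) :
    ∫ x, (G (‖x‖ ^ 2) - G (‖x‖ ^ 2 / lam ^ 2)) * f x =
      -∫ x in {x : EuclideanSpace ℝ (Fin 3) | 1 < ‖x‖ ∧ ‖x‖ < lam}, f x := by
  have hlam0 : 0 < lam := one_pos.trans hlam
  have hlam1 : lam ≤ lam ^ 2 := by nlinarith
  set S₀ := {x : EuclideanSpace ℝ (Fin 3) | 1 < ‖x‖ ∧ ‖x‖ < lam} with hS₀
  set S₁ := {x : EuclideanSpace ℝ (Fin 3) | lam < ‖x‖ ∧ ‖x‖ < lam ^ 2} with hS₁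
  set K : EuclideanSpace ℝ (Fin 3) → ℝ := fun x => G (‖x‖ ^ 2) - G (‖x‖ ^ 2 / lam ^ 2) with hK
  have hKc : Continuous K := by simp only [hK]; fun_prop
  -- integrability on the shells
  have hKf : ∀ {S : Set (EuclideanSpace ℝ (Fin 3))}, S ⊆ {x : EuclideanSpace ℝ (Fin 3) | 1 ≤ ‖x‖ ∧ ‖x‖ ≤ lam ^ 2} → MeasurableSet S →
      ∀ {g : EuclideanSpace ℝ (Fin 3) → ℝ}, Continuous g → IntegrableOn (fun x => g x * f x) S volume := by
    intro S hS hSm g hg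
    have hcl : IntegrableOn (fun x => g x * f x) {x : EuclideanSpace ℝ (Fin 3) | 1 ≤ ‖x‖ ∧ ‖x‖ ≤ lam ^ 2} volume :=
      hfi.continuousOn_mul hg.continuousOn (isCompact_shell 1 (lam ^ 2))
    exact hcl.mono_set hS
  have hS₀sub : S₀ ⊆ {x : EuclideanSpace ℝ (Fin 3) | 1 ≤ ‖x‖ ∧ ‖x‖ ≤ lam ^ 2} := fun x hx => ⟨hx.1.le, hx.2.le.trans hlam1⟩
  have hS₁sub : S₁ ⊆ {x : EuclideanSpace ℝ (Fin 3) | 1 ≤ ‖x‖ ∧ ‖x‖ ≤ lam ^ 2} :=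
    fun x hx => ⟨hlam.le.trans hx.1.le, hx.2.le⟩
  have hf₀ : IntegrableOn f S₀ volume := by
    simpa using hKf hS₀sub (measurableSet_shell 1 lam) continuous_const (g := fun _ => (1 : ℝ))
  -- Step 1: the integrand vanishes a.e. off `S₀ ∪ S₁`
  have hzero : ∀ᵐ x ∂(volume : Measure (EuclideanSpace ℝ (Fin 3))), x ∉ S₀ ∪ S₁ → K x * f x = 0 := by
    have hsph : ∀ᵐ x ∂(volume : Measure (EuclideanSpace ℝ (Fin 3))), x ∉ sphere (0 : EuclideanSpace ℝ (Fin 3)) lam := by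
      have := Measure.addHaar_sphere_of_ne_zero (volume : Measure (EuclideanSpace ℝ (Fin 3))) (0 : EuclideanSpace ℝ (Fin 3)) hlam0.ne'
      exact measure_eq_zero_iff_ae_notMem.1 this
    filter_upwards [hsph] with x hx hxS
    simp only [mem_sphere_zero_iff_norm] at hx
    simp only [hS₀, hS₁, Set.mem_union, Set.mem_setOf_eq, not_or, not_and, not_lt] at hxS
    have hK0 : K x = 0 := by
      rcases le_or_gt ‖x‖ 1 with h1 | h1
      · have e1 : G (‖x‖ ^ 2) = 1 := hG1 _ (by nlinarith [norm_nonneg x])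
        have e2 : G (‖x‖ ^ 2 / lam ^ 2) = 1 := hG1 _ (by
          rw [div_le_iff₀ (by positivity)]; nlinarith [norm_nonneg x])
        simp [hK, e1, e2]
      · have h2 : lam ≤ ‖x‖ := hxS.1 h1
        have h3 : lam ^ 2 ≤ ‖x‖ := hxS.2 (lt_of_le_of_ne h2 (Ne.symm hx))
        have e1 : G (‖x‖ ^ 2) = 0 :=
          hG0 _ (pow_le_pow_left₀ hb0.le (hb.trans (hlam1.trans h3)) 2)
        have e2 : G (‖x‖ ^ 2 / lam ^ 2) = 0 := hG0 _ (by
          rw [le_div_iff₀ (by positivity)]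
          have h4 : b * lam ≤ ‖x‖ := by nlinarith
          calc b ^ 2 * lam ^ 2 = (b * lam) ^ 2 := by ring
            _ ≤ ‖x‖ ^ 2 := pow_le_pow_left₀ (by positivity) h4 2)
        simp [hK, e1, e2]
    rw [hK0, zero_mul]
  rw [← setIntegral_eq_integral_of_ae_compl_eq_zero hzero]
  -- Step 2: split over the two shells
  have hdisj : Disjoint S₀ S₁ := Set.disjoint_left.2 fun y hy hy' => lt_asymm hy.2 hy'.1
  rw [setIntegral_union hdisj (measurableSet_shell _ _) (hKf hS₀sub (measurableSet_shell _ _) hKc)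
    (hKf hS₁sub (measurableSet_shell _ _) hKc)]
  -- Step 3: on `S₀`, `K = G(‖x‖²) − 1`
  have h0 : ∫ x in S₀, K x * f x = (∫ x in S₀, G (‖x‖ ^ 2) * f x) - ∫ x in S₀, f x := by
    rw [← integral_sub (hKf hS₀sub (measurableSet_shell _ _) (by fun_prop)) hf₀]
    refine setIntegral_congr_fun (measurableSet_shell _ _) fun x hx => ?_
    have e2 : G (‖x‖ ^ 2 / lam ^ 2) = 1 := hG1 _ (by
      rw [div_le_iff₀ (by positivity)]
      have h2 : ‖x‖ ^ 2 ≤ lam ^ 2 := pow_le_pow_left₀ (norm_nonneg _) hx.2.le 2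
      have hr2 : 1 ≤ r ^ 2 := by nlinarith
      nlinarith [mul_nonneg (sub_nonneg.2 hr2) (sq_nonneg lam)])
    simp only [hK, e2]
    ring
  -- Step 4: on `S₁`, `K = −G(‖x‖²/λ²)`, and the dilation `x = λ y` maps it back to `S₀`
  have h1 : ∫ x in S₁, K x * f x = -∫ x in S₀, G (‖x‖ ^ 2) * f x := by
    have e : ∫ x in S₁, K x * f x = -∫ x in S₁, G (‖x‖ ^ 2 / lam ^ 2) * f x := by
      rw [← integral_neg]
      refine setIntegral_congr_fun (measurableSet_shell _ _) fun x hx => ?_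
      have e1 : G (‖x‖ ^ 2) = 0 := hG0 _ (pow_le_pow_left₀ hb0.le (hb.trans hx.1.le) 2)
      simp only [hK, e1]
      ring
    rw [e]
    congr 1
    have hcov := Measure.setIntegral_comp_smul_of_pos (volume : Measure (EuclideanSpace ℝ (Fin 3)))
      (fun x : EuclideanSpace ℝ (Fin 3) => G (‖x‖ ^ 2 / lam ^ 2) * f x) S₀ hlam0
    rw [smul_shell hlam0, mul_one, ← sq, smul_eq_mul, finrank_euclideanSpace_fin] at hcov
    have hlhs : ∫ y in S₀, G (‖lam • y‖ ^ 2 / lam ^ 2) * f (lam • y) =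
        (lam ^ 3)⁻¹ * ∫ y in S₀, G (‖y‖ ^ 2) * f y := by
      rw [← integral_const_mul]
      refine setIntegral_congr_fun (measurableSet_shell _ _) fun y hy => ?_
      have hy0 : y ≠ 0 := by
        rintro rfl
        exact absurd hy.1 (by simp)
      have e : ‖lam • y‖ ^ 2 / lam ^ 2 = ‖y‖ ^ 2 := by
        rw [norm_smul, Real.norm_eq_abs, abs_of_pos hlam0, mul_pow]
        field_simp
      rw [hsc y hy0, e]
      ring
    rw [hlhs] at hcov
    exact (mul_right_injective₀ (inv_ne_zero (pow_ne_zero 3 hlam0.ne')) hcov).symm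
  rw [h0, h1]
  ring

end Summit.AnomalousDissipation.AnomalousDissipation.Theorems.ConeDesingularisation.Negative
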